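import Summits.QuantumAdvantage.QuantumAdvantage.Theorems.MobiusLadderLiouvilleNotPPolyOneTimePad
import Summits.QuantumAdvantage.QuantumAdvantage.Theorems.MobiusLadderLiouvilleNotPPolyPadOracle
import Summits.QuantumAdvantage.QuantumAdvantage.Theorems.MobiusLadderLiouvilleNotPPolyStubTwinsRefute
import Literature.Computability.Complexity.CircuitClassesProofs
import Literature.Computability.Complexity.ProbabilisticClasses
import HarnessLib

/-!
# Crux `MobiusLadder.LiouvilleNotPPoly` (stmt-QuantumAdvantage-1389), line `SketchIdeator4`,
# stub `stub_subexpTightness`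

T1b of the line (multiplicative one-time pad): **subexponential-error tightness.** For `0 < ε ≤ 1`,
a rare-error family — a language `L' ∈ P/poly` disagreeing with `L_λ = {bin(N) : λ(N) = -1}` on at
most `2^{ℓ-ℓ^ε}/16` words of every large length `ℓ` (`RareErrorFamily ε`) — already puts `L_λ` in
`P/poly`, given T1a (the pad oracle of a `P/poly` language is in `P/poly`, landed as
`stub_padOracle`; taken here as a hypothesis).

Proof. With coins `y` of length `m = (ℓ+1)^D`, `D = ⌈1/ε⌉`, the pad oracle `padOracle L' n₀` is a
`bp`-witness (Arora–Barak 2009, Def. 7.3) for `L = {x ∈ L_λ : |x| ≥ n₀}` with error `≤ 1/4`: on a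
canonical numeral `x = bin(N)` of length `ℓ ≥ n₀ ≥ 1` and coins naming `r = 2^m + ⟦y⟧`, if `L'` is
correct at `bin(r)` and at `bin(N r)` the verdict `[bin(N r) ∈ L'] ≠ [bin(r) ∈ L']` is
`[λ(N r) ≠ λ(r)] = [λ(N) = -1]` (`liouville_eq_neg_one_iff_mul_ne`); the bad coins inject, by
`y ↦ bin(r) = y1` and `y ↦ bin(N r)` (`r ↦ N r` injective), into the error sets of lengths `m+1`,
`ℓ+m`, `ℓ+m+1`, of total size `≤ 2^m/8 + 2^m/16 + 2^m/16 = 2^m/4` because `(ℓ+m)^ε ≥ m^ε =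
(ℓ+1)^{Dε} ≥ ℓ+1`; on all other inputs the oracle rejects and `x ∉ L`. Adleman
(`bp_PPoly_subset_PPoly`) gives `L ∈ P/poly`, and `L` agrees with `L_λ` on all words of length
`≥ n₀`, so the short lengths are spliced (`TwinsRefute.mem_PPoly_of_circuitSize_le_eventually`).

Sources: L. Adleman, *Two theorems on random polynomial time*, FOCS 1978; S. Arora, B. Barak,
*Computational Complexity* (2009), Def. 7.3 and Thm. 7.14. Everything used is proved tree material;
sorry-free.
-/

set_option linter.dupNamespace false -- D-0017: single-problem summit ⇒ `QuantumAdvantage.QuantumAdvantage` by design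

noncomputable section

namespace Summit.QuantumAdvantage.QuantumAdvantage.Theorems.LiouvilleNotPPoly.OneTimePad

open Literature.Computability.Complexity
open Literature.Probability.RandomGraphs.LowDegree (sgn sgn_true sgn_false)
open _root_.Computability Filter Finset Polynomial
open Summit.QuantumAdvantage.QuantumAdvantage.Theorems.MobiusLadder
open Summit.QuantumAdvantage.QuantumAdvantage.Theorems.LiouvilleOrthogonalTC0 (bits ofBits lamBit)

namespace SubexpTightness

/-! ### Words, the Liouville language, the pad oracle: membership read-backs -/

/-- `w ∈ words ℓ ↔ |w| = ℓ`. [folklore] -/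
theorem mem_words_iff {ℓ : ℕ} {w : List Bool} : w ∈ words ℓ ↔ w.length = ℓ := by
  unfold words
  rw [Finset.mem_image]
  constructor
  · rintro ⟨f, -, rfl⟩
    exact List.length_ofFn
  · rintro rfl
    exact ⟨fun i => w.get i, Finset.mem_univ _, List.ofFn_get w⟩

/-- `bin N ∈ L_λ ↔ λ(N) = -1`. [folklore] -/
theorem encodeNat_mem_liouvilleLang_iff (N : ℕ) :
    encodeNat N ∈ liouvilleLang ↔ ArithmeticFunction.liouville N = -1 :=
  Computability.Encoding.mem_toLanguage_iff encodingNatBool _ N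

/-- A word is in `L_λ` iff it is a canonical numeral whose value has `λ = -1`. [folklore] -/
theorem mem_liouvilleLang_iff {x : List Bool} :
    x ∈ liouvilleLang ↔
      encodeNat (bitsToNat x) = x ∧ ArithmeticFunction.liouville (bitsToNat x) = -1 := by
  have h : x ∈ liouvilleLang ↔
      ∃ N : ℕ, ArithmeticFunction.liouville N = -1 ∧ encodeNat N = x := by
    show x ∈ encodingNatBool.encode '' _ ↔ _
    simp only [Set.mem_image, Set.mem_setOf_eq]
    rfl
  rw [h]
  constructor
  · rintro ⟨N, hN, rfl⟩
    rw [bitsToNat_encodeNat]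
    exact ⟨rfl, hN⟩
  · rintro ⟨h1, h2⟩
    exact ⟨_, h2, h1⟩

/-- Membership of a pair `⟨x, y⟩` in the pad oracle, read back through `fstP`/`sndP`. [folklore] -/
theorem boolPair_mem_padOracle_iff (L' : Language Bool) (n₀ : ℕ) (x y : List Bool) :
    boolPair x y ∈ padOracle L' n₀ ↔
      n₀ ≤ x.length ∧ encodeNat (bitsToNat x) = x ∧
        (encodeNat (bitsToNat x * (2 ^ y.length + bitsToNat y)) ∈ L' ↔
          encodeNat (2 ^ y.length + bitsToNat y) ∉ L') := by
  refine (CoinBlocks.mem_setOf_language).trans ?_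
  simp only [fstP_boolPair, sndP_boolPair]

/-! ### The verdict of the pad oracle on good coins -/

/-- **Good coins give the right verdict.** If `L'` is correct at `bin(r)` and at `bin(N r)`
(`N, r ≠ 0`), then `[bin(N r) ∈ L'] ≠ [bin(r) ∈ L']` is `λ(N) = -1` (the pad
`λ(N) = λ(N r) λ(r)`). [folklore] -/
theorem verdict_iff {L' : Language Bool} {N r : ℕ} (hN : N ≠ 0) (hr : r ≠ 0)
    (h1 : encodeNat r ∈ liouvilleLang ↔ encodeNat r ∈ L')
    (h2 : encodeNat (N * r) ∈ liouvilleLang ↔ encodeNat (N * r) ∈ L') :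
    (encodeNat (N * r) ∈ L' ↔ encodeNat r ∉ L') ↔ ArithmeticFunction.liouville N = -1 := by
  rw [← h1, ← h2, encodeNat_mem_liouvilleLang_iff, encodeNat_mem_liouvilleLang_iff,
    liouville_eq_neg_one_iff_mul_ne hN hr]
  rcases liouville_eq_one_or_eq_neg_one (mul_ne_zero hN hr) with h | h <;>
    rcases liouville_eq_one_or_eq_neg_one hr with h' | h' <;> simp [h, h']

/-! ### Counting the bad coins -/

open Classical in
/-- **Bad coins of the first kind** (`L'` wrong at `bin(r)`, `r = 2^m + ⟦y⟧`): `y ↦ bin(r) = y 1` is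
injective into the error set of length `m + 1`. [folklore] -/
theorem card_badR_le (L' : Language Bool) (m : ℕ) :
    ((Finset.univ : Finset (List.Vector Bool m)).filter fun v =>
        ¬ (encodeNat (2 ^ m + bitsToNat v.toList) ∈ liouvilleLang ↔
            encodeNat (2 ^ m + bitsToNat v.toList) ∈ L')).card ≤
      errCount liouvilleLang L' (m + 1) := by
  unfold errCount
  refine Finset.card_le_card_of_injOn (fun v => v.toList ++ [true]) ?_ ?_
  · intro v hv
    have hv' := (Finset.mem_filter.1 hv).2
    have hr := PadOracle.encodeNat_two_pow_add_bitsToNat v.toList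
    rw [List.Vector.toList_length] at hr
    rw [hr] at hv'
    refine Finset.mem_filter.2 ⟨mem_words_iff.2 ?_, hv'⟩
    rw [List.length_append, List.Vector.toList_length, List.length_singleton]
  · intro v _ w _ hvw
    exact List.Vector.toList_injective (List.append_cancel_right hvw)

open Classical in
/-- **Bad coins of the second kind** (`L'` wrong at `bin(N r)`): for `2^k ≤ N < 2^(k+1)` the map
`y ↦ bin(N r)` is injective (`r ↦ N r` is) into the error sets of lengths `k+m+1`, `k+m+2`
(`2^(k+m) ≤ N r < 2^(k+m+2)`). [folklore] -/
theorem card_badNR_le (L' : Language Bool) {N k : ℕ} (m : ℕ) (hN1 : 2 ^ k ≤ N)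
    (hN2 : N < 2 ^ (k + 1)) :
    ((Finset.univ : Finset (List.Vector Bool m)).filter fun v =>
        ¬ (encodeNat (N * (2 ^ m + bitsToNat v.toList)) ∈ liouvilleLang ↔
            encodeNat (N * (2 ^ m + bitsToNat v.toList)) ∈ L')).card ≤
      errCount liouvilleLang L' (k + m + 1) + errCount liouvilleLang L' (k + m + 2) := by
  unfold errCount
  refine le_trans ?_ (Finset.card_union_le _ _)
  refine Finset.card_le_card_of_injOn (fun v => encodeNat (N * (2 ^ m + bitsToNat v.toList))) ?_ ?_
  · intro v hv
    have hv' := (Finset.mem_filter.1 hv).2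
    have hlt := bitsToNat_lt v.toList
    rw [List.Vector.toList_length] at hlt
    have hlo : 2 ^ (k + m) ≤ N * (2 ^ m + bitsToNat v.toList) := by
      rw [pow_add]
      exact Nat.mul_le_mul hN1 (Nat.le_add_right _ _)
    have hhi : N * (2 ^ m + bitsToNat v.toList) < 2 ^ (k + m + 2) := by
      calc N * (2 ^ m + bitsToNat v.toList) < 2 ^ (k + 1) * 2 ^ (m + 1) :=
            Nat.mul_lt_mul'' hN2 (by rw [pow_succ]; omega)
        _ = 2 ^ (k + m + 2) := by rw [← pow_add]; ring_nf
    have hle : (encodeNat (N * (2 ^ m + bitsToNat v.toList))).length ≤ k + m + 2 :=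
      (Brick.length_encodeNat_le_iff _ _).2 hhi
    have hgt : ¬ (encodeNat (N * (2 ^ m + bitsToNat v.toList))).length ≤ k + m := fun h =>
      absurd ((Brick.length_encodeNat_le_iff _ _).1 h) (not_lt.2 hlo)
    rcases (by omega : (encodeNat (N * (2 ^ m + bitsToNat v.toList))).length = k + m + 1 ∨
        (encodeNat (N * (2 ^ m + bitsToNat v.toList))).length = k + m + 2) with h | h
    · exact Finset.mem_union.2 (Or.inl (Finset.mem_filter.2 ⟨mem_words_iff.2 h, hv'⟩))
    · exact Finset.mem_union.2 (Or.inr (Finset.mem_filter.2 ⟨mem_words_iff.2 h, hv'⟩))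
  · intro v _ w _ hvw
    have h1 : N * (2 ^ m + bitsToNat v.toList) = N * (2 ^ m + bitsToNat w.toList) := by
      have := congrArg bitsToNat hvw
      simpa only [bitsToNat_encodeNat] using this
    have hN0 : 0 < N := lt_of_lt_of_le (Nat.two_pow_pos k) hN1
    have h2 := Nat.eq_of_mul_eq_mul_left hN0 h1
    have h3 : bitsToNat v.toList = bitsToNat w.toList := by omega
    have hv := PadOracle.encodeNat_two_pow_add_bitsToNat v.toList
    have hw := PadOracle.encodeNat_two_pow_add_bitsToNat w.toList
    rw [List.Vector.toList_length] at hv hw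
    rw [h3, hw] at hv
    exact List.Vector.toList_injective (List.append_cancel_right hv.symm)

/-! ### The error budget: `(ℓ + m)^ε ≥ ℓ + 1` for `m = (ℓ+1)^⌈1/ε⌉` -/

/-- For `D ε ≥ 1` and `t ≥ (n+1)^D`: `t^ε ≥ ((n+1)^D)^ε = (n+1)^{D ε} ≥ n + 1`. [folklore] -/
theorem succ_le_rpow {ε : ℝ} (hε : 0 < ε) {D n t : ℕ} (hDε : 1 ≤ (D : ℝ) * ε)
    (ht : (n + 1) ^ D ≤ t) : (n : ℝ) + 1 ≤ (t : ℝ) ^ ε := by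
  have h1 : (1 : ℝ) ≤ (n : ℝ) + 1 := by
    have := Nat.cast_nonneg (α := ℝ) n
    linarith
  have ht' : (((n + 1) ^ D : ℕ) : ℝ) ≤ (t : ℝ) := by exact_mod_cast ht
  calc (n : ℝ) + 1 = ((n : ℝ) + 1) ^ (1 : ℝ) := (Real.rpow_one _).symm
    _ ≤ ((n : ℝ) + 1) ^ ((D : ℝ) * ε) := Real.rpow_le_rpow_of_exponent_le h1 hDε
    _ = (((n : ℝ) + 1) ^ D) ^ ε := Real.rpow_natCast_mul (by positivity) D ε
    _ = (((n + 1) ^ D : ℕ) : ℝ) ^ ε := by push_cast; rfl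
    _ ≤ (t : ℝ) ^ ε := Real.rpow_le_rpow (by positivity) ht' hε.le

/-- The error set of length `m + 1` is at most `2^{m+1}/16`: `2^{(m+1) - (m+1)^ε} ≤ 2 · 2^m`.
[folklore] -/
theorem two_rpow_succ_sub_le (ε : ℝ) (m : ℕ) :
    (2 : ℝ) ^ (((m + 1 : ℕ) : ℝ) - ((m + 1 : ℕ) : ℝ) ^ ε) ≤ 2 * 2 ^ m := by
  have h0 : (0 : ℝ) ≤ ((m + 1 : ℕ) : ℝ) ^ ε := Real.rpow_nonneg (by positivity) ε
  calc (2 : ℝ) ^ (((m + 1 : ℕ) : ℝ) - ((m + 1 : ℕ) : ℝ) ^ ε) ≤ (2 : ℝ) ^ ((m + 1 : ℕ) : ℝ) :=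
        Real.rpow_le_rpow_of_exponent_le (by norm_num) (by linarith)
    _ = 2 ^ (m + 1) := Real.rpow_natCast 2 _
    _ = 2 * 2 ^ m := by ring

/-! ### The probability bound -/

open Classical in
/-- From a count of the bad coin vectors to the `bp` threshold: if the coin strings outside the
event lie in a set of at most a quarter of the `2^m` strings, the event has probability
`≥ 3/4 ≥ 2/3`. [folklore] -/
theorem two_thirds_le_uniformProb_of_card {m : ℕ} {E : Set (List Bool)}
    (B : Finset (List.Vector Bool m)) (hB : ∀ v : List.Vector Bool m, v.toList ∉ E → v ∈ B)
    (h : (B.card : ℝ) * 4 ≤ 2 ^ m) : 2 / 3 ≤ uniformProb m E := by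
  unfold uniformProb
  have hsum := Finset.card_filter_add_card_filter_not
    (s := (Finset.univ : Finset (List.Vector Bool m))) (p := fun v => v.toList ∈ E)
  rw [Finset.card_univ, card_vector, Fintype.card_bool] at hsum
  have hle : ((Finset.univ : Finset (List.Vector Bool m)).filter fun v => ¬ v.toList ∈ E).card ≤
      B.card :=
    Finset.card_le_card fun v hv => hB v (Finset.mem_filter.1 hv).2
  have hsum' :
      (((Finset.univ : Finset (List.Vector Bool m)).filter fun v => v.toList ∈ E).card : ℝ) +
        (((Finset.univ : Finset (List.Vector Bool m)).filter fun v => ¬ v.toList ∈ E).card : ℝ) =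
          2 ^ m := by
    exact_mod_cast hsum
  have hle' : ((((Finset.univ : Finset (List.Vector Bool m)).filter
      fun v => ¬ v.toList ∈ E).card : ℕ) : ℝ) ≤ B.card := by
    exact_mod_cast hle
  rw [le_div_iff₀ (by positivity)]
  linarith

open Classical in
/-- **The pad oracle is a `bp`-witness for the long part `L = {x ∈ L_λ : |x| ≥ n₀}` of `L_λ`**
with coins of length `(|x|+1)^D`, `D ε ≥ 1`, once the error sets of `L'` at all lengths `≥ T` are
`≤ 2^{ℓ-ℓ^ε}/16` and `n₀ ≥ max T 1`. [cite: AroraBarak2009, Def. 7.3] -/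
theorem two_thirds_le_uniformProb {ε : ℝ} (hε : 0 < ε) {L' L : Language Bool} {T D n₀ : ℕ}
    (hT : ∀ ℓ : ℕ, T ≤ ℓ → (errCount liouvilleLang L' ℓ : ℝ) ≤ 2 ^ ((ℓ : ℝ) - (ℓ : ℝ) ^ ε) / 16)
    (hDε : 1 ≤ (D : ℝ) * ε) (hTn₀ : T ≤ n₀) (hn₀ : 1 ≤ n₀)
    (hL : ∀ x : List Bool, x ∈ L ↔ x ∈ liouvilleLang ∧ n₀ ≤ x.length) (x : List Bool) :
    2 / 3 ≤ uniformProb ((x.length + 1) ^ D) {y | (boolPair x y ∈ padOracle L' n₀ ↔ x ∈ L)} := by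
  by_cases hx : n₀ ≤ x.length ∧ encodeNat (bitsToNat x) = x
  swap
  · -- degenerate inputs: the oracle rejects every pair and `x ∉ L`, so every coin string is right
    have hE : {y | (boolPair x y ∈ padOracle L' n₀ ↔ x ∈ L)} = (Set.univ : Set (List Bool)) := by
      refine Set.eq_univ_of_forall fun y => ?_
      rw [Set.mem_setOf_eq, boolPair_mem_padOracle_iff, hL, mem_liouvilleLang_iff]
      constructor
      · rintro ⟨h1, h2, -⟩
        exact absurd ⟨h1, h2⟩ hx
      · rintro ⟨⟨h2, -⟩, h1⟩
        exact absurd ⟨h1, h2⟩ hx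
    rw [hE, uniformProb_univ]
    norm_num
  obtain ⟨hlen, hcanon⟩ := hx
  obtain ⟨N, rfl⟩ : ∃ N, encodeNat N = x := ⟨_, hcanon⟩
  set m : ℕ := ((encodeNat N).length + 1) ^ D
  obtain ⟨k, hk⟩ : ∃ k, (encodeNat N).length = k + 1 := ⟨(encodeNat N).length - 1, by omega⟩
  have hN2 : N < 2 ^ (k + 1) := TwinsRefute.lt_two_pow_of_length_encodeNat hk
  have hN1 : 2 ^ k ≤ N := by
    by_contra h
    have := (Brick.length_encodeNat_le_iff N k).2 (not_le.1 h)
    omega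
  have hN0 : N ≠ 0 := by
    have := Nat.two_pow_pos k
    omega
  have hD0 : D ≠ 0 := by
    rintro rfl
    norm_num at hDε
  have hℓm : (encodeNat N).length + 1 ≤ m := Nat.le_self_pow hD0 _
  -- the exponent bound at the lengths `k+m+1 = ℓ+m` and `k+m+2 = ℓ+m+1`
  have key : ∀ t : ℕ, m ≤ t → t ≤ k + m + 2 → (2 : ℝ) ^ ((t : ℝ) - (t : ℝ) ^ ε) ≤ 2 ^ m := by
    intro t ht1 ht2
    have hb := succ_le_rpow hε hDε (n := (encodeNat N).length) (t := t) ht1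
    have ht2' : (t : ℝ) ≤ (k : ℝ) + m + 2 := by exact_mod_cast ht2
    have hxk : ((encodeNat N).length : ℝ) = k + 1 := by exact_mod_cast hk
    calc (2 : ℝ) ^ ((t : ℝ) - (t : ℝ) ^ ε) ≤ (2 : ℝ) ^ ((m : ℕ) : ℝ) :=
          Real.rpow_le_rpow_of_exponent_le (by norm_num) (by linarith)
      _ = 2 ^ m := Real.rpow_natCast 2 m
  -- the three error sets
  have e1 : (errCount liouvilleLang L' (m + 1) : ℝ) ≤ 2 ^ m / 8 := by
    have h := hT (m + 1) (by omega)
    have h' := two_rpow_succ_sub_le ε m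
    linarith
  have e2 : (errCount liouvilleLang L' (k + m + 1) : ℝ) ≤ 2 ^ m / 16 := by
    have h := hT (k + m + 1) (by omega)
    have h' := key (k + m + 1) (by omega) (by omega)
    linarith
  have e3 : (errCount liouvilleLang L' (k + m + 2) : ℝ) ≤ 2 ^ m / 16 := by
    have h := hT (k + m + 2) (by omega)
    have h' := key (k + m + 2) (by omega) le_rfl
    linarith
  -- good coins are in the event; the bad ones are of the two counted kinds
  refine two_thirds_le_uniformProb_of_card
    (((Finset.univ : Finset (List.Vector Bool m)).filter fun v =>
          ¬ (encodeNat (2 ^ m + bitsToNat v.toList) ∈ liouvilleLang ↔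
              encodeNat (2 ^ m + bitsToNat v.toList) ∈ L')) ∪
        ((Finset.univ : Finset (List.Vector Bool m)).filter fun v =>
          ¬ (encodeNat (N * (2 ^ m + bitsToNat v.toList)) ∈ liouvilleLang ↔
              encodeNat (N * (2 ^ m + bitsToNat v.toList)) ∈ L')))
    (fun v hv => ?_) ?_
  · rw [Finset.mem_union, Finset.mem_filter, Finset.mem_filter]
    by_contra hgood
    simp only [Finset.mem_univ, true_and, not_or, not_not] at hgood
    apply hv
    have hr0 : 2 ^ m + bitsToNat v.toList ≠ 0 := by positivity
    rw [Set.mem_setOf_eq, boolPair_mem_padOracle_iff, List.Vector.toList_length, hL,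
      bitsToNat_encodeNat, encodeNat_mem_liouvilleLang_iff, verdict_iff hN0 hr0 hgood.1 hgood.2]
    simp only [hlen, true_and, and_true]
  · have hcard := (Finset.card_union_le _ _).trans
      (add_le_add (card_badR_le L' m) (card_badNR_le L' m hN1 hN2))
    have hcard' : ((((Finset.univ : Finset (List.Vector Bool m)).filter fun v =>
          ¬ (encodeNat (2 ^ m + bitsToNat v.toList) ∈ liouvilleLang ↔
              encodeNat (2 ^ m + bitsToNat v.toList) ∈ L')) ∪
        ((Finset.univ : Finset (List.Vector Bool m)).filter fun v =>
          ¬ (encodeNat (N * (2 ^ m + bitsToNat v.toList)) ∈ liouvilleLang ↔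
              encodeNat (N * (2 ^ m + bitsToNat v.toList)) ∈ L'))).card : ℝ) ≤
      (errCount liouvilleLang L' (m + 1) : ℝ) +
        ((errCount liouvilleLang L' (k + m + 1) : ℝ) +
          (errCount liouvilleLang L' (k + m + 2) : ℝ)) := by
      exact_mod_cast hcard
    linarith

/-- The coin polynomial `(X+1)^D` evaluates to `(n+1)^D`. -/
theorem eval_coinPoly (D n : ℕ) : ((X + 1) ^ D : Polynomial ℕ).eval n = (n + 1) ^ D := by
  simp [eval_pow, eval_add, eval_X, eval_one]

/-- `D = ⌈1/ε⌉` has `D ε ≥ 1`. -/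
theorem one_le_ceil_mul {ε : ℝ} (hε : 0 < ε) : 1 ≤ (⌈1 / ε⌉₊ : ℝ) * ε := by
  have h := Nat.le_ceil (1 / ε)
  calc (1 : ℝ) = 1 / ε * ε := by field_simp
    _ ≤ (⌈1 / ε⌉₊ : ℝ) * ε := mul_le_mul_of_nonneg_right h hε.le

end SubexpTightness

open SubexpTightness in
/-- **STUB T1b · `stub_subexpTightness` — subexponential-error tightness (T1), given T1a.** For
`0 < ε ≤ 1`, a rare-error family `L'` (error `≤ 2^{ℓ-ℓ^ε}/16` at every large length `ℓ`) yields
`L_λ ∈ P/poly`: with coins of length `m = (n+1)^⌈1/ε⌉` the pad oracle `padOracle L' n₀` is a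
`bp`-witness (Arora–Barak Def. 7.3) for `{x ∈ L_λ : |x| ≥ n₀}` with error `≤ 1/4` — the bad
multipliers `r ∈ [2^m, 2^{m+1})` for an instance `N` are at most
`errCount(m+1) + errCount(n+m) + errCount(n+m+1) ≤ 2^m/4` by injectivity of `r ↦ N r` and
`(n+m)^ε ≥ n+1` — so Adleman (`bp_PPoly_subset_PPoly`) puts it in `P/poly`, and the short lengths
are spliced (`TwinsRefute.mem_PPoly_of_circuitSize_le_eventually`).
[cite: AroraBarakCC2009, Thm. 7.14] -/
theorem stub_subexpTightness :
    (∀ L' ∈ PPoly, ∀ n₀ : ℕ, padOracle L' n₀ ∈ PPoly) →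
      ∀ ε : ℝ, 0 < ε → ε ≤ 1 → RareErrorFamily ε → liouvilleLang ∈ PPoly := by
  intro hpad ε hε _ hR
  obtain ⟨L', hL', hev⟩ := hR
  obtain ⟨T, hT⟩ := Filter.eventually_atTop.1 hev
  -- the long part `L = {x ∈ L_λ : |x| ≥ n₀}` of `L_λ`, `n₀ = max T 1`
  set L : Language Bool := {x | x ∈ liouvilleLang ∧ max T 1 ≤ x.length}
  have hL : ∀ x : List Bool, x ∈ L ↔ x ∈ liouvilleLang ∧ max T 1 ≤ x.length := fun _ => Iff.rfl
  -- Step 1: `L ∈ BP·(P/poly)`, witnessed by the pad oracle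
  have hbp : L ∈ bp PPoly := by
    refine ⟨padOracle L' (max T 1), hpad L' hL' _, (X + 1) ^ ⌈1 / ε⌉₊, fun x => ?_⟩
    rw [eval_coinPoly]
    exact two_thirds_le_uniformProb hε hT (one_le_ceil_mul hε) (le_max_left _ _)
      (le_max_right _ _) hL x
  -- Step 2: Adleman
  have hPP : L ∈ PPoly := bp_PPoly_subset_PPoly hbp
  -- Step 3: splice the short lengths
  obtain ⟨p, hp⟩ := Set.mem_iUnion.1 hPP
  have hsize : ∀ n, L.circuitSize n ≤ p.eval n := (mem_SIZE_iff_circuitSize_le_holds _ _).1 hp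
  refine TwinsRefute.mem_PPoly_of_circuitSize_le_eventually p (max T 1) fun n hn => ?_
  rw [AlmostAE.circuitSize_eq_of_forall_iff (L' := L) fun y hy =>
    ((hL y).trans ⟨fun h => h.1, fun h => ⟨h, hy ▸ hn⟩⟩).symm]
  exact hsize n

end Summit.QuantumAdvantage.QuantumAdvantage.Theorems.LiouvilleNotPPoly.OneTimePad

end
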